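import Summits.Ventures.YMGap.RobustBall.LocalSourceScreeningS
import HarnessLib

/-!
# Venture YMGap, track ROBUST-BALL (Y2) — TIER 2 SCREENED STATE STABILITY: local expectations feel a modification of the
# action only through its loads NEAR the observable; loads beyond distance `r` are screened by `e^{−t r}`

HONEST FRAMING. WHAT THIS IS: a venture file (cell `pub-ymgap`, track Y2 ROBUST-BALL, seat rb-p1, theorems only): the common
refinement of `StateStabilityS.lean` (the state is Lipschitz in the action, ONE oscillation-load level `η`) and `LocalSourceScreeningS.lean`
(a source on a FINITE link set is screened at the weight rate).  HERE the modification `V` — any continuous link-summable potential, ANY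
strength, ANY range — is measured by a TWO-LEVEL profile of its one-link oscillation load `bV`: `≤ η₀` on the links within `ℓ^∞`-distance
`r` of the observable's link set `Δ`, `≤ η₁` everywhere.
* `superSolution_twoLevel` — weighted rows `Σ' C(x,y) e^{t‖x−y‖} ≤ ρ < 1` ⇒ `d(x) = (B₀ + B₁ e^{−t·max(r − dist(x,Δ), 0)})/(1 − ρ)` is a
  super-solution of Föllmer's comparison for every defect `b ≤ B₁`, `b ≤ B₀` within `r` of `Δ`;
* ★ `abs_integral_sub_integral_le_of_perturbation_screened_S` — member `W` (tier-2 loads `a`, `Λ_t` at weight `t ≥ 0`) inside the one-link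
  pair door `ρ := 6(d−1)|β| e^{a} e^{t} √(cv) + e^{a/2} √c Λ_t < 1`: EVERY DLR `μ` of `W` and EVERY DLR `ν` of `W + V` satisfy, for every
  bounded local `f` on `Δ` with Frobenius-Lipschitz vector `δ`, `|∫ f dμ − ∫ f dν| ≤ (√N/2)·(min(η₀,4) + min(η₁,4)·e^{−t r})/(1 − ρ)·Σ_{y∈Δ} δ_y`
  — THE STATE MAP `W ↦ μ_W` IS QUASI-LOCAL: what the action does beyond distance `r` from `Δ` moves `⟨f⟩` by at most
  `(√N/2)·min(η₁,4)·e^{−t r}/(1−ρ)·Σδ`, however strong;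
* `su2_screenedStabilityS_dim4` — `SU(2)`, `ℤ⁴`, hypothesis-free on `MemBallZdS a Λ t` (`6|β_W| e^{a} e^{t} + e^{a/2} √(2/3) Λ < 1`):
  `(√2/2)·(min(η₀,4) + min(η₁,4) e^{−t r})/(1 − ρ)·#Λ_F·K_F`; `su2_agreeNear_dim4` — two actions that AGREE within `r` of `Λ_F`:
  `(√2/2)·min(η₁,4)·e^{−t r}/(1−ρ)·#Λ_F·K_F` (the tier-2 thermodynamic limit of the action; `ActionTruncationRate.lean` is tier 1);
  `su2_wilson_screenedStabilityS` — the Wilson point, every weight `t ≥ 0` with `6β_W e^{t} < 1`.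
WHAT THIS IS NOT: one-sided (only the member's side contracts; nothing about uniqueness for `W + V` unless it lies in a ball); lattice
strong coupling only; nothing about the continuum limit or a Clay-sense mass gap.
-/

noncomputable section

open MeasureTheory Function Finset ProbabilityTheory Real
open scoped NNReal
open Literature.Probability.LatticeModels
open Literature.Probability.LatticeModels.DobrushinMetric
open Literature.MathematicalPhysics.QuantumLattice
open Literature.MathematicalPhysics.QuantumFieldTheory hiding ZdEdge
open Summit.QuantumFields.BalabanUV.InfraRed.StrongCouplingPoincareDoorSUN (oneLinkPoincareSUN_two_sharp)

namespace Summit.Ventures.YMGap.RobustBall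

variable {d N : ℕ}

/-! ### The two-level super-solution -/

/-- With weighted rows `Σ' C(x,y) e^{t‖x−y‖} ≤ ρ < 1` (`t ≥ 0`) and a defect `b ≤ B₁` everywhere, `b ≤ B₀` on the links within
distance `r` of `Δ`, the profile `d(x) = (B₀ + B₁ e^{−t·max(r − dist(x,Δ), 0)})/(1 − ρ)` satisfies `b x + Σ' C(x,y) d(y) ≤ d(x)`. -/
theorem superSolution_twoLevel {C : ZdEdge d → ZdEdge d → ℝ} (hC0 : ∀ x y, 0 ≤ C x y) {t ρ B₀ B₁ : ℝ} (ht : 0 ≤ t)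
    (hρ1 : ρ < 1) (hB₀ : 0 ≤ B₀) (hB₁ : 0 ≤ B₁)
    (hCs : ∀ x, Summable fun y => C x y * exp (t * ‖x.1 - y.1‖))
    (hroww : ∀ x, ∑' y, C x y * exp (t * ‖x.1 - y.1‖) ≤ ρ)
    {Δ : Finset (ZdEdge d)} {r : ℝ} {b : ZdEdge d → ℝ} (hb₁ : ∀ x, b x ≤ B₁)
    (hb₀ : ∀ x, linkSetDist Δ x ≤ r → b x ≤ B₀) (x : ZdEdge d) :
    b x + ∑' y, C x y * ((B₀ + B₁ * exp (-t * max (r - linkSetDist Δ y) 0)) / (1 - ρ)) ≤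
      (B₀ + B₁ * exp (-t * max (r - linkSetDist Δ x) 0)) / (1 - ρ) := by
  have h1ρ : 0 < 1 - ρ := sub_pos.2 hρ1
  have hρ0 : 0 ≤ ρ := le_trans (tsum_nonneg fun y => mul_nonneg (hC0 x y) (exp_pos _).le) (hroww x)
  have hcmp : ∀ y, exp (-t * max (r - linkSetDist Δ y) 0) ≤
      exp (-t * max (r - linkSetDist Δ x) 0) * exp (t * ‖x.1 - y.1‖) := fun y => by
    rw [← exp_add]
    refine exp_le_exp.2 ?_
    have h1 : linkSetDist Δ y ≤ linkSetDist Δ x + ‖x.1 - y.1‖ := by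
      have := linkSetDist_le_add_norm Δ y x; rwa [norm_sub_rev] at this
    have h2 : max (r - linkSetDist Δ x) 0 ≤ max (r - linkSetDist Δ y) 0 + ‖x.1 - y.1‖ := by
      rcases le_total (r - linkSetDist Δ x) 0 with h | h
      · rw [max_eq_right h]
        exact add_nonneg (le_max_right _ _) (norm_nonneg _)
      · rw [max_eq_left h]
        have := le_max_left (r - linkSetDist Δ y) 0
        linarith
    nlinarith
  set φ : ZdEdge d → ℝ := fun y => exp (-t * max (r - linkSetDist Δ y) 0) with hφ
  have hφ1 : ∀ y, φ y ≤ 1 := fun y => by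
    simp only [hφ]
    exact exp_le_one_iff.2 (by nlinarith [le_max_right (r - linkSetDist Δ y) 0])
  have hφ0 : ∀ y, 0 ≤ φ y := fun y => (exp_pos _).le
  have hw1 : ∀ y : ZdEdge d, 1 ≤ exp (t * ‖x.1 - y.1‖) := fun y => one_le_exp (by positivity)
  have hCs' : Summable (C x) :=
    Summable.of_nonneg_of_le (hC0 x) (fun y => le_mul_of_one_le_right (hC0 x y) (hw1 y)) (hCs x)
  have hrow : ∑' y, C x y ≤ ρ :=
    (hCs'.tsum_le_tsum (fun y => le_mul_of_one_le_right (hC0 x y) (hw1 y)) (hCs x)).trans (hroww x)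
  have hs₀ : Summable fun y => C x y * (B₀ / (1 - ρ)) := hCs'.mul_right _
  have hsum₀ : ∑' y, C x y * (B₀ / (1 - ρ)) ≤ ρ * (B₀ / (1 - ρ)) := by
    rw [tsum_mul_right]
    exact mul_le_mul_of_nonneg_right hrow (div_nonneg hB₀ h1ρ.le)
  have hs₁ : Summable fun y => C x y * (B₁ * φ y / (1 - ρ)) :=
    Summable.of_nonneg_of_le (fun y => mul_nonneg (hC0 x y) (by positivity))
      (fun y => by
        calc C x y * (B₁ * φ y / (1 - ρ)) ≤ C x y * (B₁ * (φ x * exp (t * ‖x.1 - y.1‖)) / (1 - ρ)) := by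
              gcongr
              · exact hC0 x y
              · exact hcmp y
          _ = B₁ * φ x / (1 - ρ) * (C x y * exp (t * ‖x.1 - y.1‖)) := by ring)
      ((hCs x).mul_left (B₁ * φ x / (1 - ρ)))
  have hsum₁ : ∑' y, C x y * (B₁ * φ y / (1 - ρ)) ≤ B₁ * φ x / (1 - ρ) * ρ := by
    calc ∑' y, C x y * (B₁ * φ y / (1 - ρ))
        ≤ ∑' y, B₁ * φ x / (1 - ρ) * (C x y * exp (t * ‖x.1 - y.1‖)) :=
          hs₁.tsum_le_tsum (fun y => by
            calc C x y * (B₁ * φ y / (1 - ρ)) ≤ C x y * (B₁ * (φ x * exp (t * ‖x.1 - y.1‖)) / (1 - ρ)) := by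
                  gcongr
                  · exact hC0 x y
                  · exact hcmp y
              _ = _ := by ring)
            ((hCs x).mul_left _)
      _ = B₁ * φ x / (1 - ρ) * ∑' y, C x y * exp (t * ‖x.1 - y.1‖) := tsum_mul_left
      _ ≤ B₁ * φ x / (1 - ρ) * ρ := mul_le_mul_of_nonneg_left (hroww x) (by positivity)
  have hsplit : ∑' y, C x y * ((B₀ + B₁ * φ y) / (1 - ρ)) =
      ∑' y, C x y * (B₀ / (1 - ρ)) + ∑' y, C x y * (B₁ * φ y / (1 - ρ)) := by
    rw [← hs₀.tsum_add hs₁]; exact tsum_congr fun y => by ring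
  have hbx : b x ≤ B₀ + B₁ * φ x := by
    by_cases hx : linkSetDist Δ x ≤ r
    · exact (hb₀ x hx).trans (le_add_of_nonneg_right (mul_nonneg hB₁ (hφ0 x)))
    · have hφx : φ x = 1 := by
        simp only [hφ]
        rw [max_eq_right (by linarith [not_le.1 hx]), mul_zero, exp_zero]
      rw [hφx, mul_one]
      exact (hb₁ x).trans (le_add_of_nonneg_left hB₀)
  have hfix : B₀ + B₁ * φ x + (ρ * (B₀ / (1 - ρ)) + B₁ * φ x / (1 - ρ) * ρ) = (B₀ + B₁ * φ x) / (1 - ρ) := by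
    field_simp
    ring
  calc b x + ∑' y, C x y * ((B₀ + B₁ * φ y) / (1 - ρ))
      ≤ (B₀ + B₁ * φ x) + (ρ * (B₀ / (1 - ρ)) + B₁ * φ x / (1 - ρ) * ρ) := by
        rw [hsplit]
        exact add_le_add hbx (add_le_add hsum₀ hsum₁)
    _ = (B₀ + B₁ * φ x) / (1 - ρ) := hfix

section SUN

variable {W V : Potential (ZdEdge d) (Matrix.specialUnitaryGroup (Fin N) ℂ)} {BW BV : Finset (ZdEdge d) → ℝ}

/-- ★ **TIER 2 SCREENED STATE STABILITY — the state map is quasi-local in the action.**  Member `W` (continuous, link-summable,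
tier-2 loads: oscillation `≤ a`, weighted diagonal-free cross load `≤ Λ_t` at weight `t ≥ 0`) inside the one-link pair door
`ρ := 6(d−1)|β| e^{a} e^{t} √(c v) + e^{a/2} √c Λ_t < 1`; modification `V` (continuous, link-summable, ANY strength, ANY range) whose
one-link oscillation loads `bV` are `≤ η₁` EVERYWHERE and `≤ η₀` on the links within `ℓ^∞` base-point distance `r` of `Δ`.  Then
every DLR `μ` of `W` and EVERY DLR `ν` of `W + V` satisfy, for every bounded local `f` on `Δ` with Frobenius-Lipschitz vector `δ`:
`|∫ f dμ − ∫ f dν| ≤ (√N/2)·(min(η₀,4) + min(η₁,4)·e^{−t r})/(1 − ρ) · Σ_{y ∈ Δ} δ_y`. -/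
theorem abs_integral_sub_integral_le_of_perturbation_screened_S (hd : 1 ≤ d) (hN : 1 ≤ N) {β b c v a Λt t : ℝ}
    (hc : 0 ≤ c) (hv : 0 ≤ v) (hb : |β| * (2 * ((d : ℝ) - 1)) ≤ b)
    (hP : ∀ B : Matrix (Fin N) (Fin N) ℂ, matrixOpNorm B ≤ b →
      ∀ (ψ : Matrix.specialUnitaryGroup (Fin N) ℂ → ℝ) (M : ℝ), 0 ≤ M →
        (∀ x y, |ψ x - ψ y| ≤ M * suFrobDist x y) →
        Var[ψ; (haarProbability (Matrix.specialUnitaryGroup (Fin N) ℂ)).tilted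
          fun g => (N : ℝ) * ((g : Matrix (Fin N) (Fin N) ℂ) * B).trace.re] ≤ c * M ^ 2)
    (hVB : ∀ B : Matrix (Fin N) (Fin N) ℂ, matrixOpNorm B ≤ b → ∀ Δ : Matrix (Fin N) (Fin N) ℂ,
      Var[fun g : Matrix.specialUnitaryGroup (Fin N) ℂ =>
          (N : ℝ) * ((g : Matrix (Fin N) (Fin N) ℂ) * Δ).trace.re;
        (haarProbability (Matrix.specialUnitaryGroup (Fin N) ℂ)).tilted
          fun g => (N : ℝ) * ((g : Matrix (Fin N) (Fin N) ℂ) * B).trace.re] ≤ v * frobNorm Δ ^ 2)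
    (h : IsLinkSummable W BW) (hWc : ∀ X, Continuous (W X))
    (hWdep : ∀ X, DependsOn (W X) (↑X : Set (ZdEdge d)))
    {osc : Finset (ZdEdge d) → ZdEdge d → ℝ} (hosc : ∀ X, Dobrushin.IsOscBound (W X) (osc X))
    (hoscs : ∀ e, Summable fun X : Finset (ZdEdge d) => (if e ∈ X then osc X e else 0))
    (hosca : ∀ e, ∑' X : Finset (ZdEdge d), (if e ∈ X then osc X e else 0) ≤ a)
    {lip : Finset (ZdEdge d) → ZdEdge d → ℝ} (hlip : ∀ X, IsLipBound suFrobDist (W X) (lip X))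
    {ℓ : ZdEdge d → ZdEdge d → ℝ}
    (hlips : ∀ e y, Summable fun X : Finset (ZdEdge d) => (if e ∈ X ∧ y ∈ X then lip X y else 0))
    (hℓ : ∀ e y, y ≠ e → ∑' X : Finset (ZdEdge d), (if e ∈ X ∧ y ∈ X then lip X y else 0) ≤ ℓ e y)
    (ht : 0 ≤ t) (hℓs : ∀ e, Summable fun y => (if y = e then 0 else ℓ e y) * exp (t * ‖e.1 - y.1‖))
    (hℓt : ∀ e, ∑' y, (if y = e then 0 else ℓ e y) * exp (t * ‖e.1 - y.1‖) ≤ Λt)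
    (hρ : 6 * ((d : ℝ) - 1) * |β| * (exp a * exp t * Real.sqrt (c * v)) + exp (a / 2) * Real.sqrt c * Λt < 1)
    (hV : IsLinkSummable V BV) (hVc : ∀ X, Continuous (V X)) (hVdep : ∀ X, DependsOn (V X) (↑X : Set (ZdEdge d)))
    {oscV : Finset (ZdEdge d) → ZdEdge d → ℝ} (hoscV : ∀ X, Dobrushin.IsOscBound (V X) (oscV X))
    (hoscVs : ∀ e, Summable fun X : Finset (ZdEdge d) => (if e ∈ X then oscV X e else 0))
    {bV : ZdEdge d → ℝ} (hbV : ∀ e, ∑' X : Finset (ZdEdge d), (if e ∈ X then oscV X e else 0) ≤ bV e)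
    {η₁ : ℝ} (hη₁ : ∀ e, bV e ≤ η₁) {Δ : Finset (ZdEdge d)} {r η₀ : ℝ} (hr : 0 ≤ r)
    (hη₀ : ∀ e, linkSetDist Δ e ≤ r → bV e ≤ η₀)
    {μ ν : Measure (LGConfig d (Matrix.specialUnitaryGroup (Fin N) ℂ))}
    (hμ : μ ∈ perturbedGibbsMeasuresS (d := d) (fundamentalRep (Fin N)) (N * β) W)
    (hν : ν ∈ perturbedGibbsMeasuresS (d := d) (fundamentalRep (Fin N)) (N * β) (W + V))
    {f : LGConfig d (Matrix.specialUnitaryGroup (Fin N) ℂ) → ℝ} (hfm : Measurable f)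
    (hfdep : DependsOn f (↑Δ : Set (ZdEdge d))) {M : ℝ} (hM : ∀ σ, |f σ| ≤ M)
    {δ : ZdEdge d → ℝ} (hδ : IsLipBound suFrobDist f δ) :
    |(∫ σ, f σ ∂μ) - ∫ σ, f σ ∂ν| ≤
      Real.sqrt N / 2 * (min η₀ 4 + min η₁ 4 * exp (-t * r)) /
        (1 - (6 * ((d : ℝ) - 1) * |β| * (exp a * exp t * Real.sqrt (c * v)) + exp (a / 2) * Real.sqrt c * Λt)) *
        ∑ y ∈ Δ, δ y := by
  classical
  haveI : SecondCountableTopology (Matrix (Fin N) (Fin N) ℂ) :=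
    inferInstanceAs (SecondCountableTopology (Fin N → Fin N → ℂ))
  haveI : SecondCountableTopology (Matrix.specialUnitaryGroup (Fin N) ℂ) :=
    Topology.IsEmbedding.subtypeVal.secondCountableTopology
  set ρ : ℝ := 6 * ((d : ℝ) - 1) * |β| * (exp a * exp t * Real.sqrt (c * v)) + exp (a / 2) * Real.sqrt c * Λt with hρdef
  have hWV : IsLinkSummable (W + V) (BW + BV) := h.add hV
  have hWVc : ∀ X, Continuous ((W + V) X) := fun X => (hWc X).add (hVc X)
  have hWVdep : ∀ X, DependsOn ((W + V) X) (↑X : Set (ZdEdge d)) := fun X σ τ hστ => by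
    simp only [Pi.add_apply, hWdep X hστ, hVdep X hστ]
  have hγ : IsSpecification (perturbedYMS (d := d) (fundamentalRep (Fin N)) (N * β) W) :=
    isSpecification_perturbedYMS _ (continuous_fundamentalRep (Fin N)) _ h hWc hWdep
  have hγ' : IsSpecification (perturbedYMS (d := d) (fundamentalRep (Fin N)) (N * β) (W + V)) :=
    isSpecification_perturbedYMS _ (continuous_fundamentalRep (Fin N)) _ hWV hWVc hWVdep
  have hμ' : IsGibbsMeasure (perturbedYMS (d := d) (fundamentalRep (Fin N)) (N * β) W) μ := hμ
  have hν' : IsGibbsMeasure (perturbedYMS (d := d) (fundamentalRep (Fin N)) (N * β) (W + V)) ν := hν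
  have hℓ0 : ∀ x y, y ≠ x → 0 ≤ ℓ x y := fun x y hyx => by
    refine le_trans (tsum_nonneg fun X => ?_) (hℓ x y hyx)
    split_ifs
    · exact (hlip X).nonneg y
    · exact le_rfl
  have hrow := fun x => summable_coeffS_row₀ (β := β) (c := c) (v := v) (a := a) hd hℓ0 ht hℓs hℓt x
  have hℓs' : ∀ e, Summable fun y => (if y = e then 0 else ℓ e y) := fun e =>
    Summable.of_nonneg_of_le (fun y => by split_ifs with hye; exacts [le_rfl, hℓ0 e y hye])
      (fun y => le_mul_of_one_le_right (by split_ifs with hye; exacts [le_rfl, hℓ0 e y hye])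
        (one_le_exp (by positivity))) (hℓs e)
  set C : ZdEdge d → ZdEdge d → ℝ := fun x y => if y = x then 0 else
      (exp a * Real.sqrt (c * v) * |β| * linkInfluence x y + exp (a / 2) * Real.sqrt c * ℓ x y) with hCdef
  have hC0 : ∀ x y, 0 ≤ C x y := fun x y => by
    simp only [hCdef]
    split_ifs with hyx
    · exact le_rfl
    · exact add_nonneg (by positivity) (mul_nonneg (by positivity) (hℓ0 x y hyx))
  have hd0 : 0 < d := hd
  have hρ0 : 0 ≤ ρ := (tsum_nonneg (hC0 (0, ⟨0, hd0⟩))).trans (hrow (0, ⟨0, hd0⟩)).2.2.1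
  have h1ρ : 0 < 1 - ρ := sub_pos.2 hρ
  have hbV0 : ∀ e, 0 ≤ bV e := fun e =>
    le_trans (tsum_nonneg fun X => by split_ifs; exacts [(hoscV X).nonneg e, le_rfl]) (hbV e)
  have hη₁0 : 0 ≤ min η₁ 4 := le_min ((hbV0 (0, ⟨0, hd0⟩)).trans (hη₁ _)) (by norm_num)
  have hnear0 : ∃ e, linkSetDist Δ e = 0 := by
    by_cases hΔ : Δ.Nonempty
    · obtain ⟨e, he⟩ := hΔ; exact ⟨e, linkSetDist_eq_zero_of_mem he⟩
    · exact ⟨(0, ⟨0, hd0⟩), by unfold linkSetDist; rw [dif_neg hΔ]⟩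
  have hη₀0 : 0 ≤ min η₀ 4 := by
    obtain ⟨e, he⟩ := hnear0
    exact le_min ((hbV0 e).trans (hη₀ e (by rw [he]; exact hr))) (by norm_num)
  set B₀ : ℝ := Real.sqrt N / 2 * min η₀ 4 with hB₀def
  set B₁ : ℝ := Real.sqrt N / 2 * min η₁ 4 with hB₁def
  have hB₀0 : 0 ≤ B₀ := by positivity
  have hB₁0 : 0 ≤ B₁ := by positivity
  set bdef : ZdEdge d → ℝ := fun x => Real.sqrt N / 2 * min (bV x) 4 with hbdef_def
  have hb0 : ∀ x, 0 ≤ bdef x := fun x => mul_nonneg (by positivity) (le_min (hbV0 x) (by norm_num))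
  have hb₁ : ∀ x, bdef x ≤ B₁ := fun x => mul_le_mul_of_nonneg_left (min_le_min_right 4 (hη₁ x)) (by positivity)
  have hb₀ : ∀ x, linkSetDist Δ x ≤ r → bdef x ≤ B₀ := fun x hx =>
    mul_le_mul_of_nonneg_left (min_le_min_right 4 (hη₀ x hx)) (by positivity)
  have hsuper := superSolution_twoLevel hC0 ht hρ hB₀0 hB₁0 (fun x => (hrow x).2.1) (fun x => (hrow x).2.2.2) hb₁ hb₀
  set dd : ZdEdge d → ℝ := fun y => (B₀ + B₁ * exp (-t * max (r - linkSetDist Δ y) 0)) / (1 - ρ) with hdd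
  have hdd0 : ∀ y, 0 ≤ dd y := fun y => by positivity
  have hddD : ∀ y, dd y ≤ (B₀ + B₁) / (1 - ρ) := fun y => by
    refine div_le_div_of_nonneg_right ?_ h1ρ.le
    refine add_le_add le_rfl (mul_le_of_le_one_right hB₁0 (exp_le_one_iff.2 ?_))
    nlinarith [le_max_right (r - linkSetDist Δ y) 0]
  have hker : ∀ (x : ZdEdge d) (η' : LGConfig d (Matrix.specialUnitaryGroup (Fin N) ℂ))
      (φ : Matrix.specialUnitaryGroup (Fin N) ℂ → ℝ) (L : ℝ), Measurable φ → (∃ M, ∀ s, |φ s| ≤ M) →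
      0 ≤ L → (∀ a a', |φ a - φ a'| ≤ L * suFrobDist a a') →
      |(∫ s, φ s ∂(siteLaw (perturbedYMS (fundamentalRep (Fin N)) (N * β) W) x η')) -
          ∫ s, φ s ∂(siteLaw (perturbedYMS (fundamentalRep (Fin N)) (N * β) (W + V)) x η')| ≤ bdef x * L :=
    fun x η' φ L hφm hφb hL hφL => by
      simpa only [hbdef_def] using oneLink_source_defect_S β h hWc hWdep hV hVc hVdep hoscV x (hoscVs x) (hbV x) η' φ
        L hφm hφb hL hφL
  have key := abs_integral_sub_integral_le_of_gibbs_pair_tsum hγ hγ' (by positivity : (0 : ℝ) ≤ 2 * Real.sqrt N)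
    (fun _ _ => suFrobDist_nonneg _ _) suFrobDist_le suFrobDist_self hC0 (fun x => (hrow x).1)
    (fun x ω η' φ L hφm hφb hL hφL => abs_integral_siteLaw_perturbedYMS_sub_le_tsum₀ hd hN hc hv hb hP hVB
      h hWc hWdep hosc hoscs hosca hlip hlips hℓ hℓs' x ω η' φ L hφm hφb hL hφL)
    hρ0 hρ (fun x => (hrow x).2.2.1) hμ' hν' hb0 hker hdd0 hddD hsuper hfm hfdep hM hδ
  refine key.trans (le_of_eq ?_)
  rw [Finset.mul_sum]
  refine Finset.sum_congr rfl fun y hy => ?_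
  simp only [hdd, hB₀def, hB₁def, linkSetDist_eq_zero_of_mem hy, sub_zero, max_eq_left hr]
  ring

end SUN

/-! ### `SU(2)`, `ℤ⁴`, uniformly on the weighted ball, hypothesis-free -/
/-- **`SU(2)`, `ℤ⁴` — TIER 2 SCREENED STATE STABILITY, uniformly on `MemBallZdS a Λ t`.**  `0 ≤ t`, `0 ≤ r`,
`6|β_W| e^{a} e^{t} + e^{a/2} √(2/3) Λ < 1` ⇒ for every member `W` (bare coupling `β_W/2`), every continuous link-summable modification
`V` (ANY strength, ANY range) with one-link oscillation loads `≤ η₁` everywhere and `≤ η₀` within `ℓ^∞`-distance `r` of `Λ_F`, every DLR `μ`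
of `W`, EVERY DLR `ν` of `W + V`, every Lipschitz cylinder `F`: `|∫ F dμ − ∫ F dν| ≤ (√2/2)·(min(η₀,4) + min(η₁,4)·e^{−t r})/(1 − ρ)·#Λ_F·K_F`. -/
theorem su2_screenedStabilityS_dim4 {βW a Λ t : ℝ} (ht : 0 ≤ t)
    (hρ : 6 * |βW| * (exp a * exp t) + exp (a / 2) * Real.sqrt (2 / 3) * Λ < 1)
    {W V : Potential (ZdEdge 4) (Matrix.specialUnitaryGroup (Fin 2) ℂ)} (hmem : MemBallZdS a Λ t W)
    {BV : Finset (ZdEdge 4) → ℝ} (hV : IsLinkSummable V BV) (hVc : ∀ X, Continuous (V X))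
    (hVdep : ∀ X, DependsOn (V X) (↑X : Set (ZdEdge 4)))
    {oscV : Finset (ZdEdge 4) → ZdEdge 4 → ℝ} (hoscV : ∀ X, Dobrushin.IsOscBound (V X) (oscV X))
    (hoscVs : ∀ e, Summable fun X : Finset (ZdEdge 4) => (if e ∈ X then oscV X e else 0))
    {bV : ZdEdge 4 → ℝ} (hbV : ∀ e, ∑' X : Finset (ZdEdge 4), (if e ∈ X then oscV X e else 0) ≤ bV e)
    {η₁ : ℝ} (hη₁ : ∀ e, bV e ≤ η₁) {ΛF : Finset (ZdEdge 4)} {r η₀ : ℝ} (hr : 0 ≤ r)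
    (hη₀ : ∀ e, linkSetDist ΛF e ≤ r → bV e ≤ η₀)
    {μ ν : Measure (LGConfig 4 (Matrix.specialUnitaryGroup (Fin 2) ℂ))}
    (hμ : μ ∈ perturbedGibbsMeasuresS (d := 4) (fundamentalRep (Fin 2)) (2 * (βW / 4)) W)
    (hν : ν ∈ perturbedGibbsMeasuresS (d := 4) (fundamentalRep (Fin 2)) (2 * (βW / 4)) (W + V))
    {F : LGConfig 4 (Matrix.specialUnitaryGroup (Fin 2) ℂ) → ℝ} {KF : ℝ≥0}
    (hF : IsLipschitzCylinder (fundamentalRep (Fin 2)) F ΛF KF) :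
    |(∫ σ, F σ ∂μ) - ∫ σ, F σ ∂ν| ≤
      Real.sqrt 2 / 2 * (min η₀ 4 + min η₁ 4 * exp (-t * r)) /
        (1 - (6 * |βW| * (exp a * exp t) + exp (a / 2) * Real.sqrt (2 / 3) * Λ)) * (ΛF.card * KF) := by
  classical
  haveI : SecondCountableTopology (Matrix (Fin 2) (Fin 2) ℂ) :=
    inferInstanceAs (SecondCountableTopology (Fin 2 → Fin 2 → ℂ))
  haveI : SecondCountableTopology (Matrix.specialUnitaryGroup (Fin 2) ℂ) :=
    Topology.IsEmbedding.subtypeVal.secondCountableTopology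
  obtain ⟨BW, h⟩ := hmem.summable
  obtain ⟨osc, lip, ℓ, hosc, hlip, hoscs, hosca, hlips, hℓ, hℓs, hℓt⟩ := hmem.loads
  have hc : (0 : ℝ) ≤ 2 / 3 := by norm_num
  have hP : ∀ B : Matrix (Fin 2) (Fin 2) ℂ, matrixOpNorm B ≤ |βW / 4| * (2 * (((4 : ℕ) : ℝ) - 1)) →
      ∀ (ψ : Matrix.specialUnitaryGroup (Fin 2) ℂ → ℝ) (M : ℝ), 0 ≤ M →
        (∀ x y, |ψ x - ψ y| ≤ M * suFrobDist x y) →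
        Var[ψ; (haarProbability (Matrix.specialUnitaryGroup (Fin 2) ℂ)).tilted
          fun g => ((2 : ℕ) : ℝ) * ((g : Matrix (Fin 2) (Fin 2) ℂ) * B).trace.re] ≤ 2 / 3 * M ^ 2 :=
    fun B hB ψ M hM hψ => oneLinkPoincareSUN_two_sharp _ B hB ψ M hM hψ
  have hVB := linVariance_of_poincare (N := 2) hP
  have hv : (0 : ℝ) ≤ 2 / 3 * ((2 : ℕ) : ℝ) ^ 2 := by norm_num
  have hsq : Real.sqrt (2 / 3 * (2 / 3 * ((2 : ℕ) : ℝ) ^ 2)) = 4 / 3 := by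
    rw [show (2 / 3 * (2 / 3 * ((2 : ℕ) : ℝ) ^ 2) : ℝ) = (4 / 3) ^ 2 by norm_num, Real.sqrt_sq (by norm_num)]
  have hρeq : 6 * (((4 : ℕ) : ℝ) - 1) * |βW / 4| * (exp a * exp t * Real.sqrt (2 / 3 * (2 / 3 * ((2 : ℕ) : ℝ) ^ 2))) +
      exp (a / 2) * Real.sqrt (2 / 3) * Λ = 6 * |βW| * (exp a * exp t) + exp (a / 2) * Real.sqrt (2 / 3) * Λ := by
    rw [hsq, abs_div, abs_of_pos (by norm_num : (0 : ℝ) < 4)]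
    norm_num; ring
  have hρ' : 6 * (((4 : ℕ) : ℝ) - 1) * |βW / 4| * (exp a * exp t * Real.sqrt (2 / 3 * (2 / 3 * ((2 : ℕ) : ℝ) ^ 2))) +
      exp (a / 2) * Real.sqrt (2 / 3) * Λ < 1 := by rw [hρeq]; exact hρ
  have hμ' : μ ∈ perturbedGibbsMeasuresS (d := 4) (fundamentalRep (Fin 2)) ((2 : ℕ) * (βW / 4)) W := by
    simpa using hμ
  have hν' : ν ∈ perturbedGibbsMeasuresS (d := 4) (fundamentalRep (Fin 2)) ((2 : ℕ) * (βW / 4)) (W + V) := by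
    simpa using hν
  have hA : ∀ a b : Matrix.specialUnitaryGroup (Fin 2) ℂ,
      dist (suEntries a) (suEntries b) ≤ 1 * suFrobDist a b :=
    fun a b => by rw [one_mul]; exact dist_suEntries_le_suFrobDist a b
  have key := abs_integral_sub_integral_le_of_perturbation_screened_S (N := 2) (d := 4) (by norm_num) (by norm_num) hc hv
    le_rfl hP hVB h hmem.continuous hmem.dependsOn hosc hoscs hosca hlip hlips hℓ ht hℓs hℓt hρ' hV hVc hVdep hoscV hoscVs
    hbV hη₁ hr hη₀ hμ' hν' hF.measurable hF.dependsOn hF.abs_le (hF.isLipBound zero_le_one hA)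
  rw [hρeq] at key
  refine key.trans ?_
  set ρ : ℝ := 6 * |βW| * (exp a * exp t) + exp (a / 2) * Real.sqrt (2 / 3) * Λ with hρdef
  have h1ρ : 0 < 1 - ρ := sub_pos.2 hρ
  have hbV0 : ∀ e, 0 ≤ bV e := fun e =>
    le_trans (tsum_nonneg fun X => by split_ifs; exacts [(hoscV X).nonneg e, le_rfl]) (hbV e)
  have hη₁0 : 0 ≤ min η₁ 4 := le_min ((hbV0 ((0 : Fin 4 → ℤ), (0 : Fin 4))).trans (hη₁ _)) (by norm_num)
  have hnear0 : ∃ e, linkSetDist ΛF e = 0 := by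
    by_cases hΔ : ΛF.Nonempty
    · obtain ⟨e, he⟩ := hΔ; exact ⟨e, linkSetDist_eq_zero_of_mem he⟩
    · exact ⟨((0 : Fin 4 → ℤ), (0 : Fin 4)), by unfold linkSetDist; rw [dif_neg hΔ]⟩
  have hη₀0 : 0 ≤ min η₀ 4 := by
    obtain ⟨e, he⟩ := hnear0
    exact le_min ((hbV0 e).trans (hη₀ e (by rw [he]; exact hr))) (by norm_num)
  have hK0 : 0 ≤ Real.sqrt ((2 : ℕ) : ℝ) / 2 * (min η₀ 4 + min η₁ 4 * exp (-t * r)) / (1 - ρ) := by positivity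
  have hmono : ∑ y ∈ ΛF, (if y ∈ ΛF then (1 : ℝ) * (KF : ℝ) else 0) ≤ ΛF.card * KF := by
    rw [Finset.sum_congr rfl fun y hy => by rw [if_pos hy, one_mul], Finset.sum_const, nsmul_eq_mul]
  have h2 : Real.sqrt ((2 : ℕ) : ℝ) = Real.sqrt 2 := by norm_num
  calc Real.sqrt ((2 : ℕ) : ℝ) / 2 * (min η₀ 4 + min η₁ 4 * exp (-t * r)) / (1 - ρ) *
        ∑ y ∈ ΛF, (if y ∈ ΛF then (1 : ℝ) * (KF : ℝ) else 0)
      ≤ Real.sqrt ((2 : ℕ) : ℝ) / 2 * (min η₀ 4 + min η₁ 4 * exp (-t * r)) / (1 - ρ) * (ΛF.card * KF) :=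
        mul_le_mul_of_nonneg_left hmono hK0
    _ = Real.sqrt 2 / 2 * (min η₀ 4 + min η₁ 4 * exp (-t * r)) / (1 - ρ) * (ΛF.card * KF) := by rw [h2]

/-- **`SU(2)`, `ℤ⁴` — LOCAL EXPECTATIONS DEPEND ON THE ACTION ONLY THROUGH ITS TERMS NEAR THE OBSERVABLE, UP TO `e^{−t r}`.**  If the
modification `V` (ANY strength and range, loads `≤ η₁`) has ZERO load on every link within `ℓ^∞`-distance `r` of `Λ_F` — `W` and `W + V` AGREE
near the observable — then `|∫ F dμ − ∫ F dν| ≤ (√2/2)·min(η₁,4)·e^{−t r}/(1 − ρ)·#Λ_F·K_F` (tier-2 thermodynamic limit of the action). -/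
theorem su2_agreeNear_dim4 {βW a Λ t : ℝ} (ht : 0 ≤ t)
    (hρ : 6 * |βW| * (exp a * exp t) + exp (a / 2) * Real.sqrt (2 / 3) * Λ < 1)
    {W V : Potential (ZdEdge 4) (Matrix.specialUnitaryGroup (Fin 2) ℂ)} (hmem : MemBallZdS a Λ t W)
    {BV : Finset (ZdEdge 4) → ℝ} (hV : IsLinkSummable V BV) (hVc : ∀ X, Continuous (V X))
    (hVdep : ∀ X, DependsOn (V X) (↑X : Set (ZdEdge 4)))
    {oscV : Finset (ZdEdge 4) → ZdEdge 4 → ℝ} (hoscV : ∀ X, Dobrushin.IsOscBound (V X) (oscV X))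
    (hoscVs : ∀ e, Summable fun X : Finset (ZdEdge 4) => (if e ∈ X then oscV X e else 0))
    {bV : ZdEdge 4 → ℝ} (hbV : ∀ e, ∑' X : Finset (ZdEdge 4), (if e ∈ X then oscV X e else 0) ≤ bV e)
    {η₁ : ℝ} (hη₁ : ∀ e, bV e ≤ η₁) {ΛF : Finset (ZdEdge 4)} {r : ℝ} (hr : 0 ≤ r)
    (hagree : ∀ e, linkSetDist ΛF e ≤ r → bV e ≤ 0)
    {μ ν : Measure (LGConfig 4 (Matrix.specialUnitaryGroup (Fin 2) ℂ))}
    (hμ : μ ∈ perturbedGibbsMeasuresS (d := 4) (fundamentalRep (Fin 2)) (2 * (βW / 4)) W)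
    (hν : ν ∈ perturbedGibbsMeasuresS (d := 4) (fundamentalRep (Fin 2)) (2 * (βW / 4)) (W + V))
    {F : LGConfig 4 (Matrix.specialUnitaryGroup (Fin 2) ℂ) → ℝ} {KF : ℝ≥0}
    (hF : IsLipschitzCylinder (fundamentalRep (Fin 2)) F ΛF KF) :
    |(∫ σ, F σ ∂μ) - ∫ σ, F σ ∂ν| ≤
      Real.sqrt 2 / 2 * (min η₁ 4 * exp (-t * r)) /
        (1 - (6 * |βW| * (exp a * exp t) + exp (a / 2) * Real.sqrt (2 / 3) * Λ)) * (ΛF.card * KF) := by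
  have key := su2_screenedStabilityS_dim4 ht hρ hmem hV hVc hVdep hoscV hoscVs hbV hη₁ hr hagree hμ hν hF
  simpa only [min_eq_left (by norm_num : (0 : ℝ) ≤ 4), zero_add] using key

/-- **THE `SU(2)` WILSON POINT ON `ℤ⁴`: FAR MODIFICATIONS OF THE WILSON ACTION ARE SCREENED AT EVERY RATE `t` WITH `6β_W e^{t} < 1`.**
Every continuous link-summable `V` (ANY strength, ANY range; loads `≤ η₁`, and `≤ η₀` within `r` of `Λ_F`), every DLR `μ` of the Wilson
action (bare coupling `β_W/2`), EVERY DLR `ν` of the action `+ V`: `|∫ F dμ − ∫ F dν| ≤ (√2/2)·(min(η₀,4) + min(η₁,4)·e^{−t r})/(1 − 6β_W e^{t})·#Λ_F·K_F`. -/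
theorem su2_wilson_screenedStabilityS {βW t : ℝ} (h0 : 0 ≤ βW) (ht : 0 ≤ t) (h6 : 6 * βW * exp t < 1)
    {V : Potential (ZdEdge 4) (Matrix.specialUnitaryGroup (Fin 2) ℂ)}
    {BV : Finset (ZdEdge 4) → ℝ} (hV : IsLinkSummable V BV) (hVc : ∀ X, Continuous (V X))
    (hVdep : ∀ X, DependsOn (V X) (↑X : Set (ZdEdge 4)))
    {oscV : Finset (ZdEdge 4) → ZdEdge 4 → ℝ} (hoscV : ∀ X, Dobrushin.IsOscBound (V X) (oscV X))
    (hoscVs : ∀ e, Summable fun X : Finset (ZdEdge 4) => (if e ∈ X then oscV X e else 0))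
    {bV : ZdEdge 4 → ℝ} (hbV : ∀ e, ∑' X : Finset (ZdEdge 4), (if e ∈ X then oscV X e else 0) ≤ bV e)
    {η₁ : ℝ} (hη₁ : ∀ e, bV e ≤ η₁) {ΛF : Finset (ZdEdge 4)} {r η₀ : ℝ} (hr : 0 ≤ r)
    (hη₀ : ∀ e, linkSetDist ΛF e ≤ r → bV e ≤ η₀)
    {μ ν : Measure (LGConfig 4 (Matrix.specialUnitaryGroup (Fin 2) ℂ))}
    (hμ : μ ∈ ymGibbsMeasures (d := 4) (fundamentalRep (Fin 2)) (2 * (βW / 4)))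
    (hν : ν ∈ perturbedGibbsMeasuresS (d := 4) (fundamentalRep (Fin 2)) (2 * (βW / 4)) (0 + V))
    {F : LGConfig 4 (Matrix.specialUnitaryGroup (Fin 2) ℂ) → ℝ} {KF : ℝ≥0}
    (hF : IsLipschitzCylinder (fundamentalRep (Fin 2)) F ΛF KF) :
    |(∫ σ, F σ ∂μ) - ∫ σ, F σ ∂ν| ≤
      Real.sqrt 2 / 2 * (min η₀ 4 + min η₁ 4 * exp (-t * r)) / (1 - 6 * βW * exp t) * (ΛF.card * KF) := by
  have hmem : MemBallZdS (d := 4) (N := 2) 0 0 t 0 := memBallZdS_zero le_rfl le_rfl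
  have hρ : 6 * |βW| * (exp 0 * exp t) + exp (0 / 2) * Real.sqrt (2 / 3) * 0 < 1 := by
    rw [abs_of_nonneg h0]; simpa using h6
  have hW0s : (0 : Potential (ZdEdge 4) (Matrix.specialUnitaryGroup (Fin 2) ℂ)).IsSupportedBy
      fun _ => (∅ : Finset (Finset (ZdEdge 4))) := fun Λ X _ h0 => absurd rfl h0
  have hμ' : μ ∈ perturbedGibbsMeasuresS (d := 4) (fundamentalRep (Fin 2)) (2 * (βW / 4)) 0 := by
    unfold perturbedGibbsMeasuresS
    rw [perturbedYMS_eq_perturbedYM (fundamentalRep (Fin 2)) (2 * (βW / 4)) (W := 0) hW0s]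
    change μ ∈ perturbedGibbsMeasures (d := 4) (fundamentalRep (Fin 2)) (2 * (βW / 4)) 0 fun _ => ∅
    rw [perturbedGibbsMeasures_zero]; exact hμ
  have key := su2_screenedStabilityS_dim4 ht hρ hmem hV hVc hVdep hoscV hoscVs hbV hη₁ hr hη₀ hμ' hν hF
  refine key.trans (le_of_eq ?_)
  rw [abs_of_nonneg h0]
  simp

end Summit.Ventures.YMGap.RobustBall

end
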